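import Summits.CriticalPhenomena.CardyFormulaZ2.Theses.CardyWickAnisotropy
import Summits.CriticalPhenomena.CardyFormulaZ2.Theses.CardyMonotoneApproach
import Summits.CriticalPhenomena.CardyFormulaZ2.Theorems.RectilinearCardy.Negative.RectilinearCardySquareInstance
import Summits.CriticalPhenomena.CardyFormulaZ2.Theorems.CardyWickAnisotropyBoxFamilyToCardyStubBoxFamilyToZ2QuadLowerBound
import Summits.CriticalPhenomena.CardyFormulaZ2.Theorems.CardyWickAnisotropyBoxFamilyToCardyStubZ2QuadLowerBoundToBoxes
import Summits.CriticalPhenomena.CardyFormulaZ2.Theorems.CardyWickAnisotropyBoxFamilyToCardyStubZ2BoxesToRectCardy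
import Literature.Probability.Percolation.QuadCrossingRotationInvarianceOfThm21
import Literature.Probability.Percolation.QuadCrossingContinuityEventsDischarge
import Literature.Probability.RandomPlanarGeometry.RectangleModulusAspectRatio
import Literature.Probability.RandomPlanarGeometry.ConformalRectangleProofs
import HarnessLib

/-!
# Crux `BoxFamilyToCardy` (stmt-CriticalPhenomena-14215), line `birth`: the KNOWN HALF, assembled

Route `CardyWickAnisotropy` of `CardyFormulaZ2`; crux `BoxFamilyToCardy : AnisotropicBoxCardy → CardyFormulaZ2`.
This file composes the three landed glue stubs of the line (`stub_boxFamilyToZ2QuadLowerBound`,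
`stub_z2QuadLowerBoundToBoxes`, `stub_z2BoxesToRectCardy`, all sorry-free tree theorems of this
namespace) into the route's foreseen layer-2 child **IsotropicRectangles** and records what the crux
now reduces to:

* `isotropicRectangles_of_dkkmo` — DKKMO Thm 2.1 (`q = 1`) → DKKMO Cor. 1.3 → `AnisotropicBoxCardy` →
  `CardyMonotoneApproach.RectCardy` (Cardy's formula for every corner-marked axis-parallel rectangle of
  bond-`ℤ²` at `p = 1/2`, the sibling TARGET stmt-CriticalPhenomena-5843, by name);
* `isotropicRectangles_of_thm21` — the same with Cor. 1.3 discharged from Thm 2.1 and the tree's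
  Schramm–Smirnov Lemma 5.1 (`dkkmo_crossing_rotation_invariance_of_thm21_of_lemma_5_1`,
  `SchrammSmirnov2011_lemma_5_1_holds`): the known half rests on EXACTLY ONE unproved named fact,
  `Literature.Probability.Percolation.DKKMO2020_thm21_quadCrossingProb` (DKKMO arXiv:2012.11672 Thm 2.1);
* `exists_rect_datum_of_mem_Ioo` — every `η ∈ (0,1)` is the cross-ratio of a uniformizing datum of some
  corner-marked rectangle (tree theorems only);
* `boxFamilyToCardy_of_thm21_of_rectanglesToConformal` — the crux from Thm 2.1 and the MINIMAL open
  residue `RectCardy → CardyFormulaZ2` ("rectangles → all conformal rectangles");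
* `boxFamilyToCardy_of_thm21_of_confInvTransport` — the crux from Thm 2.1 and the shared open sibling
  crux `CardyMonotoneApproach.ConfInvTransport` (stmt-CriticalPhenomena-0794, conformal invariance of
  bond-`ℤ²` crossing limits in transport form), which implies that residue by realising every modulus
  with a rectangle.

Everything here is a real proof over tree theorems; the two remaining obligations of the line are the
named fact (stub `stub_dkkmoUniversality`) and the open problem (stub `stub_confInvTransport`).
-/

open Filter Topology Set
open UpperHalfPlane (upperHalfPlaneSet)
open Literature.Probability.RandomPlanarGeometry
open Literature.Probability.Percolation (bondDomainCrossingProb DKKMO2020_thm21_quadCrossingProb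
  dkkmo_crossing_rotation_invariance)
open Summit.CriticalPhenomena.CardyFormulaZ2.Theses.CardyWickAnisotropy (AnisotropicBoxCardy
  BoxFamilyToCardy)
open Summit.CriticalPhenomena.CardyFormulaZ2.Theses.CardyMonotoneApproach (RectCardy ConfInvTransport)

namespace Summit.CriticalPhenomena.CardyFormulaZ2.Cruxes.BoxFamilyToCardy.Birth

/-- **IsotropicRectangles (the known half of the crux, modulo the two DKKMO named facts).** DKKMO
Thm 2.1 (`q = 1`) and Cor. 1.3, taken as hypotheses, carry Cardy along the anisotropic self-dual box
family (`AnisotropicBoxCardy`) to Cardy's formula for every corner-marked axis-parallel rectangle of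
bond-`ℤ²` at `p = 1/2` (`CardyMonotoneApproach.RectCardy`). Composition of the line's three landed
glue stubs: lower bounds for Schramm–Smirnov crossings of `ℤ²` rectangles (2a), Cardy for the exact
box-crossing probabilities `crossingProb half (p m) (q m − 1)` (2b), Smirnov's discretised rectangles
(2c). [cite: DKKMO2020Rotational, Thm 2.1 and Cor. 1.3 (q = 1)] -/
theorem isotropicRectangles_of_dkkmo :
    DKKMO2020_thm21_quadCrossingProb → dkkmo_crossing_rotation_invariance →
      AnisotropicBoxCardy → RectCardy :=
  fun h21 hrot hA =>
    stub_z2BoxesToRectCardy (stub_z2QuadLowerBoundToBoxes (stub_boxFamilyToZ2QuadLowerBound h21 hrot hA))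

/-- **IsotropicRectangles from Thm 2.1 alone.** DKKMO Cor. 1.3 at `q = 1`
(`dkkmo_crossing_rotation_invariance`) is a tree consequence of Thm 2.1 and Schramm–Smirnov's
Lemma 5.1, the latter DISCHARGED for bond-`ℤ²` (`SchrammSmirnov2011_lemma_5_1_holds`); hence the known
half of the crux rests on the single named fact `DKKMO2020_thm21_quadCrossingProb`.
[cite: DKKMO2020Rotational, Thm 2.1 (q = 1)] -/
theorem isotropicRectangles_of_thm21 :
    DKKMO2020_thm21_quadCrossingProb → AnisotropicBoxCardy → RectCardy :=
  fun h21 hA =>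
    isotropicRectangles_of_dkkmo h21
      (Literature.Probability.Percolation.dkkmo_crossing_rotation_invariance_of_thm21_of_lemma_5_1 h21
        Literature.Probability.Percolation.QuadCrossing.SchrammSmirnov2011_lemma_5_1_holds) hA

/-- Every `η ∈ (0,1)` is the cross-ratio of a uniformizing datum of some corner-marked axis-parallel
rectangle `(0,w)×(0,h)` (marks `ih, 0, w, w+ih`): the rectangle modulus is onto `(0,1)`
(`rectangle_crossRatio_eq_of_aspectRatio_holds`), corner-marked rectangles exist (`exists_brRect`),
and uniformizing data exist (`MarkedDomain.exists_isUniformizing_holds`). This is the sibling support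
`CardyMonotoneApproach.RectRealises`, proved. [folklore] -/
theorem exists_rect_datum_of_mem_Ioo {η : ℝ} (hη : η ∈ Ioo (0:ℝ) 1) :
    ∃ (R : ConformalRectangle) (w h : ℝ) (φ : ConformalEquiv upperHalfPlaneSet R.carrier)
      (x : Fin 4 → ℝ), 0 < w ∧ 0 < h ∧ R.carrier = Ioo (0:ℝ) w ×ℂ Ioo (0:ℝ) h ∧
      (R.pt 0 = (h:ℂ) * Complex.I ∧ R.pt 1 = 0 ∧ R.pt 2 = (w:ℂ) ∧ R.pt 3 = (w:ℂ) + (h:ℂ) * Complex.I) ∧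
      R.IsUniformizing φ x ∧ crossRatio x = η := by
  obtain ⟨g, -, himg, hall⟩ := rectangle_crossRatio_eq_of_aspectRatio_holds
  have hη' : η ∈ g '' Ioi 0 := by rw [himg]; exact hη
  obtain ⟨r, hr, hgr⟩ := hη'
  obtain ⟨R, hcar, hpt⟩ :=
    Summit.CriticalPhenomena.CardyFormulaZ2.Theorems.RectilinearCardy.Negative.exists_brRect r 1 hr
      one_pos
  obtain ⟨φ, x, hφx⟩ := MarkedDomain.exists_isUniformizing_holds R
  refine ⟨R, r, 1, φ, x, hr, one_pos, hcar, hpt, hφx, ?_⟩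
  rw [hall R r 1 hr one_pos hcar hpt φ x hφx, div_one, hgr]

/-- **The crux from Thm 2.1 and the minimal open residue "rectangles → conformal rectangles".**
If DKKMO Thm 2.1 (`q = 1`) holds and Cardy for corner-marked rectangles implies Cardy for all
conformal rectangles of bond-`ℤ²` (`RectCardy → CardyFormulaZ2`, the open half: it is where conformal —
not merely similarity — invariance of the `ℤ²` crossing limits enters), then `BoxFamilyToCardy`.
[cite: DKKMO2020Rotational, Thm 2.1 (q = 1)] -/
theorem boxFamilyToCardy_of_thm21_of_rectanglesToConformal (h21 : DKKMO2020_thm21_quadCrossingProb)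
    (hRC : RectCardy → CardyFormulaZ2) : BoxFamilyToCardy :=
  fun hA => hRC (isotropicRectangles_of_thm21 h21 hA)

/-- **The crux from Thm 2.1 and conformal transport** (`CardyMonotoneApproach.ConfInvTransport`, the
shared open sibling crux stmt-CriticalPhenomena-0794): given `X_A`, the known half yields `RectCardy`;
for an arbitrary conformal rectangle `R'` with uniformizing datum `(φ', x')`, realise
`η' = crossRatio x' ∈ (0,1)` by a corner-marked rectangle `R` with datum `(φ, x)`
(`exists_rect_datum_of_mem_Ioo`), read Cardy on `R`, and transport the limit to `R'`. This is the
line's composition `BoxFamilyToCardy_of` with the three glue stubs discharged; what it still takes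
as hypotheses are exactly the line's two open stubs. [cite: DKKMO2020Rotational, Thm 2.1 (q = 1)] -/
theorem boxFamilyToCardy_of_thm21_of_confInvTransport (h21 : DKKMO2020_thm21_quadCrossingProb)
    (hCIT : ConfInvTransport) : BoxFamilyToCardy := by
  intro hA
  have hRC : RectCardy := isotropicRectangles_of_thm21 h21 hA
  intro R' φ' x' h'
  obtain ⟨R, w, h, φ, x, hw, hh, hcar, hpt, hφx, hη⟩ :=
    exists_rect_datum_of_mem_Ioo (ConformalRectangle.crossRatio_mem_Ioo_of_isUniformizing h')
  have hlim : Tendsto (bondDomainCrossingProb R) (𝓝[>] 0) (𝓝 (cardyFunction (crossRatio x))) :=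
    hRC R w h hw hh hcar hpt φ x hφx
  have hlim' := hCIT R R' φ x φ' x' hφx h' hη _ hlim
  rw [hη] at hlim'
  exact hlim'

end Summit.CriticalPhenomena.CardyFormulaZ2.Cruxes.BoxFamilyToCardy.Birth
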